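import Summits.BirchSwinnertonDyer.BirchSwinnertonDyer.Theorems.PrintCf2SplitBadTwoShaFiniteOfFrame
import Summits.BirchSwinnertonDyer.BirchSwinnertonDyer.Theorems.PrintCf2SplitBadTwoRestrictedSelmerCokernelOfLocSurjFinite
import Summits.BirchSwinnertonDyer.BirchSwinnertonDyer.Theorems.PrintCf2SplitBadTwoRestrictedSelmerLeadingTerm
import Summits.BirchSwinnertonDyer.BirchSwinnertonDyer.Theorems.PrintCf2SplitBadTwoRestrictedSelmerCMSideConditions
import HarnessLib

/-!
# Route C `PrintCf2RubinValueTwo`, item `RestrictedSelmerControlAtTwo` (stmt-BirchSwinnertonDyer-23723, S3c) —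
# THE ITEM'S OWN HYPOTHESES MAKE `Ш(W/ℚ)[2^∞]` FINITE: the `Nat.card` in its conclusion is never the junk value `0`

Cell `bsd-print-cf2`, width seat `bsd-line-cf2c-w2` g0 (prover-bsd-line-cf2c-w2-g0-0); `--supports stmt-BirchSwinnertonDyer-23723` (helper,
Theses-free). HONEST FRAMING: nothing here closes the item; BSD is not proved by any of this; no summit statement is proved by this seat.
THEOREMS ONLY (no definition, no named fact, no `sorry`, no kit). beyond-print theorem: no (bookkeeping over tree theorems).

WHY. The route-C vet (refuter bsd-vet-cf2-C g0, AUDIT-23723, finding F6) recorded: «`Nat.card Ш[2^∞]` junk-0 if infinite — finiteness comes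
from the fact bundle». It does NOT need the fact bundle: under the item's OWN binders — a restricted dual datum `D` (Agboola) for the pinned summand
`W* = E[𝔮_r^∞]` along the line `κ'` unramified outside `v̄`, finitely generated over `Λ` with `D.HasCharValuationAt n` — the chain
`D.HasCharValuationAt n` ⟹ `𝔖_{v̄}(K*_∞, W*)^Γ` finite (-w7 `finite_endInvariants_of_hasCharValuationAt`, Greenberg LNM 1716 §4 Lemma 4.2)
⟹ `𝔖_{v̄}(K, W*)` finite (control kernel `⊥` unconditionally on the frame, -w6 g2 / -w5 g3
`finite_restrictedSelmerBase_of_frame_of_finite_endInvariants`, Agboola §3 Prop. 3.2) ⟹ `Ш(W/ℚ)[2^∞]` and `Ш(W_K/K)[2^∞]` finite (-w6 g4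
`CMPrimes.finite_sha_two_primary_of_frame` / `…_baseChange_of_frame`, the middle factor of the three-factor decomposition, Agboola Props. 6.5,
6.10–6.11 + Gross (5.1)) runs on tree theorems only. So in the closer of 23723 (`RubinValueTwoControl.restrictedSelmerControlAtTwo_of_levelCounts`,
p680824, and its unconditional successor) the term `padicValNat 2 (Nat.card (AddCommGroup.primaryComponent W.sha 2))` is the `2`-adic
valuation of a genuine finite cardinality on every instance the item quantifies over — for the referee's hypothesis-by-hypothesis audit.

WHAT.
* `finite_restrictedSelmerBase_of_restrictedDual` — item binders through `D.HasCharValuationAt n` ⟹ `Finite 𝔖_{v̄}(K, W*)` (the `hfin`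
  binder of every (F3)/hcounts/(PI)/(PIN)/(ShaFin) display, supplied from the item's datum);
* `finite_sha_two_primary_of_restrictedDual`, `finite_sha_two_primary_baseChange_of_restrictedDual`, `natCard_sha_two_primary_ne_zero_of_restrictedDual`;
* **`restrictedSelmerControlAtTwo_binders_finite_sha`** — the same over the item's binder list VERBATIM (copied from the route decl / cut 16), ending in
  `Finite (Ш(W/ℚ)[2^∞]) ∧ Finite (Ш(W_K/K)[2^∞]) ∧ 0 < #Ш(W/ℚ)[2^∞] ∧ 0 < #Ш(W_K/K)[2^∞]`.
presearch: not applicable (assembly of tree theorems). playbook: none fit.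

References: A. Agboola, Compositio 143 (2007) §3 Prop. 3.2, §5, §6 Props. 6.5, 6.10–6.11 [Agboola2007]; R. Greenberg, LNM 1716 (1999) §3
Lemmas 3.1–3.3, §4 Lemma 4.2 [GreenbergLNM1716]; B. H. Gross, in: L-functions and Arithmetic, LMS LNS 153 (1991) §5 (5.1) [GrossLMS1991].
-/

noncomputable section

open scoped Classical

set_option linter.dupNamespace false
set_option autoImplicit false

open NumberField IsDedekindDomain Field WeierstrassCurve
open Literature.NumberTheory.EllipticCurves Literature.NumberTheory.EllipticCurves.GreenbergSelmer
open Literature.NumberTheory.EllipticCurves.Agboola2007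
open Literature.NumberTheory.EllipticCurves.IwasawaAlgebra
open Literature.NumberTheory.EllipticCurves.IwasawaDual
open Literature.NumberTheory.EllipticCurves.ResKernel
open Literature.NumberTheory.GaloisRepresentations
open Summit.BirchSwinnertonDyer.BirchSwinnertonDyer.Theorems.PrintCf2.AdditiveAtSeven
open Summit.BirchSwinnertonDyer.BirchSwinnertonDyer.Theorems.GoldfeldGoodTwists
open Summit.BirchSwinnertonDyer.BirchSwinnertonDyer.Theorems.PrintCf2.RestrictedSelmerPair

namespace Summit.BirchSwinnertonDyer.BirchSwinnertonDyer.Theorems.PrintCf2.RubinValueTwoControl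

variable {K : Type} [Field K] [NumberField K]

/-- **The item's datum makes the bottom finite: `Module.Finite Λ D.X` ∧ `D.HasCharValuationAt n` ⟹ `𝔖_{v̄}(K, W*)` finite** on every
S3c frame (`𝔖^Γ` finite by the characteristic valuation, Greenberg §4 Lemma 4.2 / -w7; control kernel `⊥` on the frame, Agboola Prop. 3.2 /
-w5 g3). This is the `hfin` binder of the (F3)/hcounts displays, read off the item's own hypotheses.
[cite: GreenbergLNM1716, §4 Lemma 4.2] [cite: Agboola2007, §3 Prop. 3.2, §5] -/
theorem finite_restrictedSelmerBase_of_restrictedDual {d : ℤ} (hd0 : d ≠ 0)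
    (W : WeierstrassCurve ℚ) [W.IsElliptic] (C : VariableChange ℚ) (hC : C • W = cm7.quadraticTwist (d : ℚ))
    (hK : IsImaginaryQuadratic K) {v vbar : HeightOneSpectrum (𝓞 K)} (hv : ((2 : ℕ) : 𝓞 K) ∈ v.asIdeal)
    (hvbar : ((2 : ℕ) : 𝓞 K) ∈ vbar.asIdeal) (hne : vbar ≠ v) (π : (W.baseChange K).endRing)
    (hrel : (π : AddMonoid.End (W.baseChange K).geomPoints) * π = π - 2) {r : ℤ_[2]} (hr : r * r = r - 2)
    (κ' : ZpExtension K 2) (hκ' : κ'.IsUnramifiedOutside vbar) {γ' : absoluteGaloisGroup K} (hγ' : κ'.IsTopGenerator γ')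
    (D : Agboola2007.RestrictedDualData κ' ↥((W.baseChange K).endEigenPrimaryTorsion 2 π r) vbar γ') {n : ℕ}
    (hDf : Module.Finite (IwasawaAlgebra 2) D.X) (hDn : D.HasCharValuationAt n) :
    Finite (restrictedSelmerBase ↥((W.baseChange K).endEigenPrimaryTorsion 2 π r) 2 vbar) := by
  haveI : Fact (Nat.Prime 2) := ⟨Nat.prime_two⟩
  haveI := hDf
  obtain ⟨hfinI, -⟩ := finite_endInvariants_of_hasCharValuationAt D
    (exists_pow_smul_endEigenPrimaryTorsion_eq_zero (W.baseChange K) 2 π r)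
    (isOpen_stabilizer_endEigenPrimaryTorsion (W.baseChange K) 2 π r) hγ' hDn
  haveI := hfinI
  exact finite_restrictedSelmerBase_of_frame_of_finite_endInvariants hd0 W C hC hK hv hvbar hne π hrel hr κ' hκ' γ'

/-- **`Ш(W/ℚ)[2^∞]` is finite under the item's own binders** (frame, pinned summand, line `κ'`, datum `D` with `Module.Finite` and
`HasCharValuationAt n`, ℚ-generator datum): `finite_restrictedSelmerBase_of_restrictedDual` then -w6 g4's (ShaFin)
`CMPrimes.finite_sha_two_primary_of_frame`. [cite: Agboola2007, §6 Props. 6.5, 6.10–6.11] [cite: GrossLMS1991, §5 (5.1)] -/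
theorem finite_sha_two_primary_of_restrictedDual {d : ℤ} (hd0 : d ≠ 0) (hsq : Squarefree d) (hd4 : d % 4 ≠ 1)
    (W : WeierstrassCurve ℚ) [W.IsElliptic] [W.IsGloballyMinimal] (C : VariableChange ℚ) (hC : C • W = cm7.quadraticTwist (d : ℚ))
    (hrank : W.analyticRank = 1) (hK : IsImaginaryQuadratic K) {v vbar : HeightOneSpectrum (𝓞 K)}
    (hv : ((2 : ℕ) : 𝓞 K) ∈ v.asIdeal) (hvbar : ((2 : ℕ) : 𝓞 K) ∈ vbar.asIdeal) (hne : vbar ≠ v)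
    (π : (W.baseChange K).endRing) (hrel : (π : AddMonoid.End (W.baseChange K).geomPoints) * π = π - 2)
    {r : ℤ_[2]} (hr : r * r = r - 2)
    (hpin : ∀ τ ∈ GreenbergSelmer.inertia v, ∀ x : ↥((W.baseChange K).endEigenPrimaryTorsion 2 π r), τ • x = x ∨ τ • x = -x)
    (κ' : ZpExtension K 2) (hκ' : κ'.IsUnramifiedOutside vbar) {γ' : absoluteGaloisGroup K} (hγ' : κ'.IsTopGenerator γ')
    (D : Agboola2007.RestrictedDualData κ' ↥((W.baseChange K).endEigenPrimaryTorsion 2 π r) vbar γ') {n : ℕ}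
    (hDf : Module.Finite (IwasawaAlgebra 2) D.X) (hDn : D.HasCharValuationAt n)
    {P : W.toAffine.Point} {c₀ : ℕ} {ℓ : ℤ} (hP : ¬ IsOfFinAddOrder P)
    (hgen : ∀ R : W.toAffine.Point, ∃ (k : ℤ) (T : W.toAffine.Point), IsOfFinAddOrder T ∧ R = k • P + T)
    (hc₀ : c₀ ≠ 0) (hker : (W.baseChange ℚ_[2]).IsInReductionKernel (c₀ • W.toPadicPoint 2 P))
    (hlog : ‖(W.baseChange ℚ_[2]).padicLogPoint (c₀ • W.toPadicPoint 2 P) / (c₀ : ℚ_[2])‖ = (2 : ℝ) ^ (-ℓ)) :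
    Finite (AddCommGroup.primaryComponent W.sha 2) :=
  CMPrimes.finite_sha_two_primary_of_frame d hd0 hsq hd4 W C hC hrank K hK v vbar hv hvbar hne π hrel r hr hpin P c₀ ℓ hP hgen
    hc₀ hker hlog (finite_restrictedSelmerBase_of_restrictedDual hd0 W C hC hK hv hvbar hne π hrel hr κ' hκ' hγ' D hDf hDn)

/-- **`Ш(W_K/K)[2^∞]` is finite under the item's own binders** (same chain, -w6 g4 `CMPrimes.finite_sha_two_primary_baseChange_of_frame`:
`#Ш(W_K)[2^∞] = (#Ш(W/ℚ)[2^∞])²`). [cite: Agboola2007, §6 Props. 6.10–6.11] [cite: GrossLMS1991, §5 (5.1)] -/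
theorem finite_sha_two_primary_baseChange_of_restrictedDual {d : ℤ} (hd0 : d ≠ 0) (hsq : Squarefree d) (hd4 : d % 4 ≠ 1)
    (W : WeierstrassCurve ℚ) [W.IsElliptic] [W.IsGloballyMinimal] (C : VariableChange ℚ) (hC : C • W = cm7.quadraticTwist (d : ℚ))
    (hrank : W.analyticRank = 1) (hK : IsImaginaryQuadratic K) {v vbar : HeightOneSpectrum (𝓞 K)}
    (hv : ((2 : ℕ) : 𝓞 K) ∈ v.asIdeal) (hvbar : ((2 : ℕ) : 𝓞 K) ∈ vbar.asIdeal) (hne : vbar ≠ v)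
    (π : (W.baseChange K).endRing) (hrel : (π : AddMonoid.End (W.baseChange K).geomPoints) * π = π - 2)
    {r : ℤ_[2]} (hr : r * r = r - 2)
    (hpin : ∀ τ ∈ GreenbergSelmer.inertia v, ∀ x : ↥((W.baseChange K).endEigenPrimaryTorsion 2 π r), τ • x = x ∨ τ • x = -x)
    (κ' : ZpExtension K 2) (hκ' : κ'.IsUnramifiedOutside vbar) {γ' : absoluteGaloisGroup K} (hγ' : κ'.IsTopGenerator γ')
    (D : Agboola2007.RestrictedDualData κ' ↥((W.baseChange K).endEigenPrimaryTorsion 2 π r) vbar γ') {n : ℕ}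
    (hDf : Module.Finite (IwasawaAlgebra 2) D.X) (hDn : D.HasCharValuationAt n)
    {P : W.toAffine.Point} {c₀ : ℕ} {ℓ : ℤ} (hP : ¬ IsOfFinAddOrder P)
    (hgen : ∀ R : W.toAffine.Point, ∃ (k : ℤ) (T : W.toAffine.Point), IsOfFinAddOrder T ∧ R = k • P + T)
    (hc₀ : c₀ ≠ 0) (hker : (W.baseChange ℚ_[2]).IsInReductionKernel (c₀ • W.toPadicPoint 2 P))
    (hlog : ‖(W.baseChange ℚ_[2]).padicLogPoint (c₀ • W.toPadicPoint 2 P) / (c₀ : ℚ_[2])‖ = (2 : ℝ) ^ (-ℓ)) :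
    Finite (AddCommGroup.primaryComponent (W.baseChange K).sha 2) :=
  CMPrimes.finite_sha_two_primary_baseChange_of_frame d hd0 hsq hd4 W C hC hrank K hK v vbar hv hvbar hne π hrel r hr hpin P c₀ ℓ
    hP hgen hc₀ hker hlog (finite_restrictedSelmerBase_of_restrictedDual hd0 W C hC hK hv hvbar hne π hrel hr κ' hκ' hγ' D hDf hDn)

/-- **The `Nat.card` in 23723's conclusion is a genuine cardinality**: under the item's binders `#Ш(W/ℚ)[2^∞] ≠ 0` (finite, inhabited).
[cite: Agboola2007, §6 Props. 6.10–6.11] -/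
theorem natCard_sha_two_primary_ne_zero_of_restrictedDual {d : ℤ} (hd0 : d ≠ 0) (hsq : Squarefree d) (hd4 : d % 4 ≠ 1)
    (W : WeierstrassCurve ℚ) [W.IsElliptic] [W.IsGloballyMinimal] (C : VariableChange ℚ) (hC : C • W = cm7.quadraticTwist (d : ℚ))
    (hrank : W.analyticRank = 1) (hK : IsImaginaryQuadratic K) {v vbar : HeightOneSpectrum (𝓞 K)}
    (hv : ((2 : ℕ) : 𝓞 K) ∈ v.asIdeal) (hvbar : ((2 : ℕ) : 𝓞 K) ∈ vbar.asIdeal) (hne : vbar ≠ v)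
    (π : (W.baseChange K).endRing) (hrel : (π : AddMonoid.End (W.baseChange K).geomPoints) * π = π - 2)
    {r : ℤ_[2]} (hr : r * r = r - 2)
    (hpin : ∀ τ ∈ GreenbergSelmer.inertia v, ∀ x : ↥((W.baseChange K).endEigenPrimaryTorsion 2 π r), τ • x = x ∨ τ • x = -x)
    (κ' : ZpExtension K 2) (hκ' : κ'.IsUnramifiedOutside vbar) {γ' : absoluteGaloisGroup K} (hγ' : κ'.IsTopGenerator γ')
    (D : Agboola2007.RestrictedDualData κ' ↥((W.baseChange K).endEigenPrimaryTorsion 2 π r) vbar γ') {n : ℕ}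
    (hDf : Module.Finite (IwasawaAlgebra 2) D.X) (hDn : D.HasCharValuationAt n)
    {P : W.toAffine.Point} {c₀ : ℕ} {ℓ : ℤ} (hP : ¬ IsOfFinAddOrder P)
    (hgen : ∀ R : W.toAffine.Point, ∃ (k : ℤ) (T : W.toAffine.Point), IsOfFinAddOrder T ∧ R = k • P + T)
    (hc₀ : c₀ ≠ 0) (hker : (W.baseChange ℚ_[2]).IsInReductionKernel (c₀ • W.toPadicPoint 2 P))
    (hlog : ‖(W.baseChange ℚ_[2]).padicLogPoint (c₀ • W.toPadicPoint 2 P) / (c₀ : ℚ_[2])‖ = (2 : ℝ) ^ (-ℓ)) :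
    Nat.card (AddCommGroup.primaryComponent W.sha 2) ≠ 0 := by
  haveI := finite_sha_two_primary_of_restrictedDual hd0 hsq hd4 W C hC hrank hK hv hvbar hne π hrel hr hpin κ' hκ' hγ' D hDf hDn
    hP hgen hc₀ hker hlog
  exact Nat.card_pos.ne'

/-- **OVER THE ITEM'S BINDER LIST VERBATIM** (route decl `…Theses.PrintCf2RubinValueTwo.RestrictedSelmerControlAtTwo` / cut 16, up to and
including the `‖log‖` clause): `Ш(W/ℚ)[2^∞]` and `Ш(W_K/K)[2^∞]` are finite with positive cardinality. So the `padicValNat 2 (Nat.card …)` term of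
the item's conclusion is honest on every instance. [cite: Agboola2007, §3 Prop. 3.2, §5, §6 Props. 6.5, 6.10–6.11] [cite: GreenbergLNM1716, §4 Lemma 4.2]
[cite: GrossLMS1991, §5 (5.1)] -/
theorem restrictedSelmerControlAtTwo_binders_finite_sha :
    ∀ (d : ℤ), d ≠ 0 → Squarefree d → d % 4 ≠ 1 →
    ∀ (W : WeierstrassCurve ℚ) [W.IsElliptic] [W.IsGloballyMinimal] (C : VariableChange ℚ),
      C • W = cm7.quadraticTwist (d : ℚ) → W.analyticRank = 1 →
    ∀ (K : Type) [Field K] [NumberField K], IsImaginaryQuadratic K →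
    ∀ (v vbar : HeightOneSpectrum (𝓞 K)),
      ((2 : ℕ) : 𝓞 K) ∈ v.asIdeal → ((2 : ℕ) : 𝓞 K) ∈ vbar.asIdeal → vbar ≠ v →
    ∀ (π : (W.baseChange K).endRing), (π : AddMonoid.End (W.baseChange K).geomPoints) * π = π - 2 →
    ∀ (r : ℤ_[2]), r * r = r - 2 →
      (∀ τ ∈ GreenbergSelmer.inertia v, ∀ x : ↥((W.baseChange K).endEigenPrimaryTorsion 2 π r), τ • x = x ∨ τ • x = -x) →
    ∀ (κ' : ZpExtension K 2), κ'.IsUnramifiedOutside vbar → ∀ (γ' : absoluteGaloisGroup K), κ'.IsTopGenerator γ' →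
    ∀ (D : Agboola2007.RestrictedDualData κ' ↥((W.baseChange K).endEigenPrimaryTorsion 2 π r) vbar γ') (n : ℕ),
      Module.Finite (IwasawaAlgebra 2) D.X → D.HasCharValuationAt n →
    ∀ (P : W.toAffine.Point) (c₀ : ℕ) (ℓ : ℤ),
      ¬ IsOfFinAddOrder P →
      (∀ R : W.toAffine.Point, ∃ (k : ℤ) (T : W.toAffine.Point), IsOfFinAddOrder T ∧ R = k • P + T) →
      c₀ ≠ 0 → (W.baseChange ℚ_[2]).IsInReductionKernel (c₀ • W.toPadicPoint 2 P) →
      ‖(W.baseChange ℚ_[2]).padicLogPoint (c₀ • W.toPadicPoint 2 P) / (c₀ : ℚ_[2])‖ = (2 : ℝ) ^ (-ℓ) →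
      Finite (AddCommGroup.primaryComponent W.sha 2) ∧ Finite (AddCommGroup.primaryComponent (W.baseChange K).sha 2) ∧
        0 < Nat.card (AddCommGroup.primaryComponent W.sha 2) ∧ 0 < Nat.card (AddCommGroup.primaryComponent (W.baseChange K).sha 2) := by
  intro d hd0 hsq hd4 W _ _ C hC hrank K _ _ hK v vbar hv hvbar hne π hrel r hr hpin κ' hκ' γ' hγ' D n hDf hDn P c₀ ℓ hP hgen hc₀ hker hlog
  have hfin := finite_restrictedSelmerBase_of_restrictedDual hd0 W C hC hK hv hvbar hne π hrel hr κ' hκ' hγ' D hDf hDn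
  have h := CMPrimes.natCard_sha_two_primary_pos_of_frame d hd0 hsq hd4 W C hC hrank K hK v vbar hv hvbar hne π hrel r hr hpin P c₀ ℓ
    hP hgen hc₀ hker hlog hfin
  exact ⟨CMPrimes.finite_sha_two_primary_of_frame d hd0 hsq hd4 W C hC hrank K hK v vbar hv hvbar hne π hrel r hr hpin P c₀ ℓ
      hP hgen hc₀ hker hlog hfin,
    CMPrimes.finite_sha_two_primary_baseChange_of_frame d hd0 hsq hd4 W C hC hrank K hK v vbar hv hvbar hne π hrel r hr hpin P c₀ ℓ
      hP hgen hc₀ hker hlog hfin, h.1, h.2⟩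

end Summit.BirchSwinnertonDyer.BirchSwinnertonDyer.Theorems.PrintCf2.RubinValueTwoControl

end
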